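import Summits.AtomisticToContinuum.HydrodynamicLimit.Theorems.KineticCurrentsWindowLDUniform.Negative.WindowFubini

/-!
# The window functional and its drifted-Gibbs mean (crux `KineticCurrentsWindowLDUniform`, 2/3)

Negative-knowledge infrastructure for the crux `OneFlightGossipEngine.KineticCurrentsWindowLDUniform`
(stmt-AtomisticToContinuum-14662), from the standing disprover's `Cruxes/KineticCurrentsWindowLDUniform/Disproof.lean`
§ 3; part 2 of `Negative/{WindowFubini, WindowSum, TiltWindow, LoadBearing}`. The kinetic-window functional
`(∑ i, w⁻¹ * ∫ r in (0 : ℝ)..w, g ((Φ.flow r z) i).2) = ∑ᵢ w⁻¹ ∫₀ʷ g(vᵢ(r)) dr` of a continuous one-body velocity observable of polynomial growth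
`|g| ≤ C(1+‖v‖²)^m` along ANY hard-sphere flow `Φ`: a.e.-measurable under every law carried by the good set
(tree: joint measurability of the flow), dominated on the good set by the CONSERVED kinetic energy
(`|W| ≤ (N+1)C(1+2E)^m`, tree: `configEnergy_eq_holds`), hence integrable under the drifted homogeneous Gibbs law
`G_N^{u₁} = localGibbsLaw σ 1 u₁ 1 N Φ`, with mean `∫ W dG_N^{u₁} = (N+1) E_{N(u₁,I)} g` by Fubini in time + flow-invariance
(`integral_windowSum`, from part 1's `integral_window_eq_of_integrable`). refuter-cdisprove-stmt-AtomisticToContinuum-14662-0.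
-/

noncomputable section

namespace Summit.AtomisticToContinuum.HydrodynamicLimit.Theorems
namespace KineticCurrentsWindowTilt

open MeasureTheory ProbabilityTheory Filter Set Topology Real
open scoped ENNReal NNReal InnerProductSpace
open Literature.MathematicalPhysics.KineticTheory Literature.Analysis.FluidPDE

/-! ### C. The drift-tilt lower bound for window exponential functionals -/

section Tilt

variable {σ : ℝ} {N : ℕ}

/-- Scalars come out of the window functional:
`∑ᵢ w⁻¹∫₀ʷ β g(vᵢ(r)) dr = β ∑ᵢ w⁻¹∫₀ʷ g(vᵢ(r)) dr`. [folklore] -/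
theorem window_sum_const_mul (Φ : HardSphereFlow (Torus.geometry (Fin 3)) (hsDiameter σ N) (N + 1))
    (w β : ℝ) (g : V3 → ℝ) (z : Config (N + 1) (Fin 3) T3) :
    (∑ i, w⁻¹ * ∫ r in (0 : ℝ)..w, β * g ((Φ.flow r z) i).2) =
      β * ∑ i, w⁻¹ * ∫ r in (0 : ℝ)..w, g ((Φ.flow r z) i).2 := by
  rw [Finset.mul_sum]
  refine Finset.sum_congr rfl fun i _ => ?_
  rw [intervalIntegral.integral_const_mul]
  ring

/-- A window term is a.e.-measurable under every law carried by the good set. [folklore] -/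
theorem aemeasurable_window_term (Φ : HardSphereFlow (Torus.geometry (Fin 3)) (hsDiameter σ N) (N + 1))
    (w : ℝ) {g : V3 → ℝ} (hg : Measurable g) (i : Fin (N + 1)) {μ : Measure (Config (N + 1) (Fin 3) T3)}
    (hμ : μ Φ.goodᶜ = 0) : AEMeasurable (fun z => ∫ r in (0 : ℝ)..w, g ((Φ.flow r z) i).2) μ :=
  Φ.aemeasurable_intervalIntegral_comp_flow_torus (f := fun z => g (z i).2)
    (hg.comp (measurable_pi_apply i).snd) 0 w hμ

/-- The window functional is a.e.-measurable under every law carried by the good set. [folklore] -/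
theorem aemeasurable_windowSum (Φ : HardSphereFlow (Torus.geometry (Fin 3)) (hsDiameter σ N) (N + 1))
    (w : ℝ) {g : V3 → ℝ} (hg : Measurable g) {μ : Measure (Config (N + 1) (Fin 3) T3)}
    (hμ : μ Φ.goodᶜ = 0) : AEMeasurable (fun z => ∑ i, w⁻¹ * ∫ r in (0 : ℝ)..w, g ((Φ.flow r z) i).2) μ := by
  have h : ∀ i : Fin (N + 1), AEMeasurable (fun z => w⁻¹ * ∫ r in (0 : ℝ)..w, g ((Φ.flow r z) i).2) μ :=
    fun i => (aemeasurable_window_term Φ w hg i hμ).const_mul _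
  have := Finset.aemeasurable_sum (Finset.univ : Finset (Fin (N + 1))) (fun i _ => h i)
  refine this.congr (ae_of_all _ fun z => ?_)
  simp

/-- On the good set a window term of a polynomially bounded observable is dominated by the (conserved)
kinetic energy: `|∫₀ʷ g(vᵢ(r)) dr| ≤ C (1 + 2E(z))^m w` for `w > 0`. [folklore] -/
theorem abs_window_term_le (Φ : HardSphereFlow (Torus.geometry (Fin 3)) (hsDiameter σ N) (N + 1))
    {w : ℝ} (hw : 0 < w) {g : V3 → ℝ} {C : ℝ} {m : ℕ} (hC : ∀ v, |g v| ≤ C * (1 + ‖v‖ ^ 2) ^ m)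
    {z : Config (N + 1) (Fin 3) T3} (hz : z ∈ Φ.good) (i : Fin (N + 1)) :
    |∫ r in (0 : ℝ)..w, g ((Φ.flow r z) i).2| ≤ C * (1 + 2 * configEnergy z) ^ m * w := by
  have hC0 : 0 ≤ C := by
    have h0 := (abs_nonneg _).trans (hC 0)
    have : 0 < ((1 : ℝ) + ‖(0 : V3)‖ ^ 2) ^ m := by positivity
    nlinarith
  have hE : ∀ r, configEnergy (Φ.flow r z) = configEnergy z := by
    intro r
    have h := IsHardSphereTrajectory.configEnergy_eq_holds (Φ.isTrajectory z hz) r 0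
    simpa [Φ.flow_zero z hz] using h
  have hbd : ∀ r ∈ Set.uIoc (0 : ℝ) w, ‖g ((Φ.flow r z) i).2‖ ≤ C * (1 + 2 * configEnergy z) ^ m := by
    intro r _
    rw [Real.norm_eq_abs]
    refine (hC _).trans (mul_le_mul_of_nonneg_left (pow_le_pow_left₀ (by positivity) ?_ m) hC0)
    have := AprioriBoundsNegative.norm_vel_sq_le_two_mul_configEnergy (Φ.flow r z) i
    rw [hE r] at this
    linarith
  have hint := intervalIntegral.norm_integral_le_of_norm_le_const hbd
  rwa [Real.norm_eq_abs, sub_zero, abs_of_pos hw] at hint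

/-- Hence `|W(z)| ≤ (N+1)·C·(1 + 2E(z))^m` on the good set. [folklore] -/
theorem abs_windowSum_le (Φ : HardSphereFlow (Torus.geometry (Fin 3)) (hsDiameter σ N) (N + 1))
    {w : ℝ} (hw : 0 < w) {g : V3 → ℝ} {C : ℝ} {m : ℕ} (hC : ∀ v, |g v| ≤ C * (1 + ‖v‖ ^ 2) ^ m)
    {z : Config (N + 1) (Fin 3) T3} (hz : z ∈ Φ.good) :
    |(∑ i, w⁻¹ * ∫ r in (0 : ℝ)..w, g ((Φ.flow r z) i).2)| ≤ (N + 1) * (C * (1 + 2 * configEnergy z) ^ m) := by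
  have hterm : ∀ i : Fin (N + 1), |w⁻¹ * ∫ r in (0 : ℝ)..w, g ((Φ.flow r z) i).2| ≤
      C * (1 + 2 * configEnergy z) ^ m := by
    intro i
    rw [abs_mul, abs_inv, abs_of_pos hw]
    calc w⁻¹ * |∫ r in (0 : ℝ)..w, g ((Φ.flow r z) i).2| ≤ w⁻¹ * (C * (1 + 2 * configEnergy z) ^ m * w) :=
          mul_le_mul_of_nonneg_left (abs_window_term_le Φ hw hC hz i) (inv_nonneg.2 hw.le)
      _ = C * (1 + 2 * configEnergy z) ^ m := by field_simp
  refine (Finset.abs_sum_le_sum_abs _ _).trans ?_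
  calc ∑ i, |w⁻¹ * ∫ r in (0 : ℝ)..w, g ((Φ.flow r z) i).2|
      ≤ ∑ _i : Fin (N + 1), C * (1 + 2 * configEnergy z) ^ m := Finset.sum_le_sum fun i _ => hterm i
    _ = (N + 1) * (C * (1 + 2 * configEnergy z) ^ m) := by simp

variable (hσ2 : σ ≤ 1 / 2)
include hσ2

/-- The drifted homogeneous Gibbs law `G_N^{u₁}` is a probability measure (`σ ≤ 1/2`). [folklore] -/
theorem isProbabilityMeasure_driftLaw (u₁ : V3)
    (Φ : HardSphereFlow (Torus.geometry (Fin 3)) (hsDiameter σ N) (N + 1)) :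
    IsProbabilityMeasure (localGibbsLaw σ (fun _ => 1) (fun _ => u₁) (fun _ => 1) N Φ) := by
  rw [localGibbsLaw_eq]
  exact isProbabilityMeasure_localGibbsMeasure (a₀ := fun _ : T3 => (1 : ℝ))
    (θ₀ := fun _ : T3 => (1 : ℝ)) (u₀ := fun _ : T3 => u₁) continuous_const continuous_const
    continuous_const (fun _ => one_pos) (fun _ => one_pos) hσ2 N

omit hσ2 in
/-- The drifted Gibbs law gives zero mass to the complement of the good set. [folklore] -/
theorem driftLaw_compl_good (u₁ : V3)
    (Φ : HardSphereFlow (Torus.geometry (Fin 3)) (hsDiameter σ N) (N + 1)) :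
    (localGibbsLaw σ (fun _ => 1) (fun _ => u₁) (fun _ => 1) N Φ) Φ.goodᶜ = 0 :=
  (withDensity_absolutelyContinuous _ _) Φ.measure_compl_good

/-- `z ↦ C (1 + 2E(z))^m w'` is integrable under the drifted Gibbs law. [folklore] -/
theorem integrable_energy_pow (u₁ : V3)
    (Φ : HardSphereFlow (Torus.geometry (Fin 3)) (hsDiameter σ N) (N + 1)) (C w' : ℝ) (m : ℕ) :
    Integrable (fun z : Config (N + 1) (Fin 3) T3 => C * (1 + 2 * configEnergy z) ^ m * w')
      (localGibbsLaw σ (fun _ => 1) (fun _ => u₁) (fun _ => 1) N Φ) := by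
  have hE : Integrable (fun z : Config (N + 1) (Fin 3) T3 => (1 + 2 * configEnergy z) ^ m) (localGibbsLaw σ (fun _ => 1) (fun _ => u₁) (fun _ => 1) N Φ) := by
    rw [localGibbsLaw_eq]
    exact integrable_one_add_two_mul_configEnergy_pow hσ2 one_pos one_pos u₁ N m
  exact (hE.const_mul C).mul_const w'

/-- A window term of a continuous polynomially bounded observable is integrable under the drifted Gibbs law
(domination by the conserved, Gibbs-integrable kinetic energy on the conull good set). [folklore] -/
theorem integrable_window_term (Φ : HardSphereFlow (Torus.geometry (Fin 3)) (hsDiameter σ N) (N + 1))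
    (u₁ : V3) {w : ℝ} (hw : 0 < w) {g : V3 → ℝ} (hg : Continuous g) {C : ℝ} {m : ℕ}
    (hC : ∀ v, |g v| ≤ C * (1 + ‖v‖ ^ 2) ^ m) (i : Fin (N + 1)) :
    Integrable (fun z => ∫ r in (0 : ℝ)..w, g ((Φ.flow r z) i).2) (localGibbsLaw σ (fun _ => 1) (fun _ => u₁) (fun _ => 1) N Φ) := by
  refine (integrable_energy_pow hσ2 u₁ Φ C w m).mono'
    (aemeasurable_window_term Φ w hg.measurable i (driftLaw_compl_good u₁ Φ)).aestronglyMeasurable ?_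
  have hae : ∀ᵐ z ∂(localGibbsLaw σ (fun _ => 1) (fun _ => u₁) (fun _ => 1) N Φ), z ∈ Φ.good := by
    have := compl_mem_ae_iff.2 (driftLaw_compl_good u₁ Φ)
    rwa [compl_compl] at this
  filter_upwards [hae] with z hz
  rw [Real.norm_eq_abs]
  exact abs_window_term_le Φ hw hC hz i

/-- The window functional is integrable under the drifted Gibbs law. [folklore] -/
theorem integrable_windowSum (Φ : HardSphereFlow (Torus.geometry (Fin 3)) (hsDiameter σ N) (N + 1))
    (u₁ : V3) {w : ℝ} (hw : 0 < w) {g : V3 → ℝ} (hg : Continuous g) {C : ℝ} {m : ℕ}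
    (hC : ∀ v, |g v| ≤ C * (1 + ‖v‖ ^ 2) ^ m) : Integrable (fun z => ∑ i, w⁻¹ * ∫ r in (0 : ℝ)..w, g ((Φ.flow r z) i).2) (localGibbsLaw σ (fun _ => 1) (fun _ => u₁) (fun _ => 1) N Φ) := by
  have := integrable_finsetSum (Finset.univ : Finset (Fin (N + 1)))
    fun i _ => (integrable_window_term hσ2 Φ u₁ hw hg hC i).const_mul w⁻¹
  refine this.congr (ae_of_all _ fun z => ?_)
  simp

/-- **Mean of a window term under the (invariant) drifted Gibbs law**: Fubini in time + stationarity
+ one-body reduction, `∫ (∫₀ʷ g(vᵢ(r)) dr) dQ = w ∫ g d(gaussMeasure u₁ 1)`. [folklore] -/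
theorem integral_window_term (Φ : HardSphereFlow (Torus.geometry (Fin 3)) (hsDiameter σ N) (N + 1))
    (u₁ : V3) {w : ℝ} (hw : 0 < w) {g : V3 → ℝ} (hg : Continuous g) {C : ℝ} {m : ℕ}
    (hC : ∀ v, |g v| ≤ C * (1 + ‖v‖ ^ 2) ^ m) (i : Fin (N + 1)) :
    ∫ z, (∫ r in (0 : ℝ)..w, g ((Φ.flow r z) i).2) ∂(localGibbsLaw σ (fun _ => 1) (fun _ => u₁) (fun _ => 1) N Φ) =
      w * ∫ v, g v ∂gaussMeasure u₁ 1 := by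
  haveI := isProbabilityMeasure_driftLaw hσ2 u₁ Φ
  have hfi : Integrable (fun z : Config (N + 1) (Fin 3) T3 => g ((z i).2)) (localGibbsLaw σ (fun _ => 1) (fun _ => u₁) (fun _ => 1) N Φ) := by
    rw [localGibbsLaw_eq]
    exact integrable_vel_localGibbsMeasure_const hσ2 one_pos one_pos u₁ N i hg hC
  have h := integral_window_eq_of_integrable σ 1 1 u₁ N Φ (f := fun z => g ((z i).2))
    (hg.measurable.comp (measurable_pi_apply i).snd) hfi hw
  rw [h, localGibbsLaw_eq, integral_vel_localGibbsMeasure_const hσ2 one_pos one_pos u₁ N i hg]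

/-- **Mean of the window functional under the drifted Gibbs law**: `∫ W dQ = (N+1) ∫ g d(gaussMeasure u₁ 1)`. [folklore] -/
theorem integral_windowSum (Φ : HardSphereFlow (Torus.geometry (Fin 3)) (hsDiameter σ N) (N + 1))
    (u₁ : V3) {w : ℝ} (hw : 0 < w) {g : V3 → ℝ} (hg : Continuous g) {C : ℝ} {m : ℕ}
    (hC : ∀ v, |g v| ≤ C * (1 + ‖v‖ ^ 2) ^ m) :
    ∫ z, (∑ i, w⁻¹ * ∫ r in (0 : ℝ)..w, g ((Φ.flow r z) i).2) ∂(localGibbsLaw σ (fun _ => 1) (fun _ => u₁) (fun _ => 1) N Φ) =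
      (N + 1) * ∫ v, g v ∂gaussMeasure u₁ 1 := by
  rw [integral_finsetSum _ fun i _ => (integrable_window_term hσ2 Φ u₁ hw hg hC i).const_mul w⁻¹]
  simp_rw [integral_const_mul, integral_window_term hσ2 Φ u₁ hw hg hC, ← mul_assoc,
    inv_mul_cancel₀ hw.ne', one_mul]
  simp

end Tilt

end KineticCurrentsWindowTilt
end Summit.AtomisticToContinuum.HydrodynamicLimit.Theorems

end
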